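import Literature.Geometry.Lorentzian.HarmonicallyFlat
import Literature.Analysis.FluidPDE.NewtonPotential
import HarnessLib

/-!
# Bray's expansion (10) of a harmonic conformal factor at infinity — proof
# (discharge of `Literature.Geometry.Lorentzian.Bray2001_harmonicFactor_expansion`)

Bray, J. Differential Geom. 59 (2001) 177–267 (arXiv:math/9911173, same numbering), §2, the
sentence before (10): *"since `𝒰₀(x)` is a harmonic function going to a constant at infinity,
we may expand it in terms of spherical harmonics to get `𝒰₀(x) = a + b/|x| + O(1/|x|²)`"*.
`HarmonicallyFlat.lean` records this as the named fact `Bray2001_harmonicFactor_expansion`: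
a function `U : E3 → ℝ`, harmonic (Mathlib's `InnerProductSpace.HarmonicOnNhd`) on an exterior
region `{R₁ < ‖x‖}` of `ℝ³` and tending to `a` along `Bornology.cobounded E3`, satisfies
`HasHarmonicExpansion U a b` (`U - (a + b/|x|) = O(|x|⁻²)`) for some `b`. This file proves it
(`Bray2001_harmonicFactor_expansion_holds`, fully proved) from the potential theory already in the
tree — `Literature/Analysis/FluidPDE/NewtonKernel`, `NewtonPotential`: the Newtonian kernel
`Γ(z) = -(4π|z|)⁻¹` (`newtonKernel`), its splitting `Γ = Γ₀ + Γ∞` by the radial cutoff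
(`newtonNear`, `newtonFar`), the weight `λ = ΔΓ∞` (`newtonFarLaplacian`, supported in the
annulus `r₀ ≤ |z| ≤ r₁`, `∫|λ^{ρr₀,ρr₁}|` independent of `ρ`), and the localised Green
representation formula `∫ Γ₀ Δφ = φ(0) - ∫ λ φ` for `φ ∈ C²(ℝ³)`
(`integral_newtonNear_mul_laplacian`, Gilbarg–Trudinger (2.16)–(2.17)).

## The proof (Green's representation instead of spherical harmonics)

Bray points to the expansion of a function harmonic at infinity in spherical harmonics
(Folland, Prop. 2.74–2.75: Kelvin transform and a removable singularity), which Mathlib cannot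
presently support. Instead: put `V = U - a` (harmonic on `{R < |x|}`, `R = max R₁ 1`, `V → 0`)
and cut it off near the hole, `W = (1 - θ_{R+1,R+2}) V`; then `W ∈ C²(ℝ³)`, `W = V` on
`{|x| ≥ R + 2}`, `W → 0` at infinity, and `ΔW` is continuous and vanishes off `|x| ≤ R + 2`.

* `eq_integral_newtonKernel_mul_laplacian` — **Green's representation formula**, boundary-free
  form: `W(x) = ∫ Γ(x - y) ΔW(y) dy` whenever `W ∈ C²(ℝ³)`, `ΔW` vanishes off a ball and
  `W → 0` at infinity (Gilbarg–Trudinger (2.17) states it for compactly supported `W`; the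
  decay `W → 0` alone kills the term at infinity): apply `∫ Γ₀^{ρ,2ρ} Δφ = φ(0) - ∫ λ^{ρ,2ρ} φ`
  to `φ = W(x - ·)`; for `ρ ≥ |x| + S` the left side is `∫ Γ(x - y) ΔW(y) dy`, while
  `|∫ λ^{ρ,2ρ}(z) W(x - z) dz| ≤ ‖λ^{1,2}‖₁ · sup_{|w| ≥ ρ - |x|} |W| → 0` as `ρ → ∞`.
* `newtonPotential_sub_isBigO` — **far field of a Newtonian potential**: for continuous `f`
  vanishing off `|y| ≤ S`, `∫ Γ(x - y) f(y) dy = -(4π)⁻¹ (∫ f) |x|⁻¹ + O(|x|⁻²)`, from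
  `|1/|x - y| - 1/|x|| = ||x| - |x - y|| / (|x| |x - y|) ≤ 2S/|x|²` for `|x| ≥ 2S`.
* `Bray2001_harmonicFactor_expansion_holds` — the discharge, with `b = -(4π)⁻¹ ∫ ΔW`.

Nothing is defined and no fact is introduced; the statement proved is the one vendored in
`HarmonicallyFlat.lean`, unchanged.

## References

* H. L. Bray, *Proof of the Riemannian Penrose inequality using the positive mass theorem*,
  J. Differential Geom. 59 (2001) 177–267, §2, (9)–(10) and Def. 2.
* D. Gilbarg, N. S. Trudinger, *Elliptic partial differential equations of second order*
  (2001), §2.4, (2.16)–(2.17) (Green's representation formula).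
* G. B. Folland, *Introduction to Partial Differential Equations* (2nd ed.), Prop. 2.74–2.75
  (the spherical-harmonics route, not followed here).
-/

noncomputable section

open Set Filter Asymptotics Bornology Metric MeasureTheory Topology InnerProductSpace
open scoped Real Laplacian ContDiff

namespace Literature.Geometry.Lorentzian

open Literature.Analysis.FluidPDE

/-! ### Green's representation formula for `C²` functions vanishing at infinity -/

/-- **Green's representation formula on `ℝ³`, boundary-free form.** If `W ∈ C²(ℝ³)`, `ΔW`
vanishes off the ball `|y| ≤ S`, and `W → 0` at infinity, then for every `x`,
`W(x) = ∫ Γ(x - y) ΔW(y) dy` with `Γ(z) = -(4π|z|)⁻¹` (`newtonKernel`). Gilbarg–Trudinger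
(2.17) (printed for compactly supported `W`); proved from the localised identity
`∫ Γ₀^{ρ,2ρ} Δφ = φ(0) - ∫ λ^{ρ,2ρ} φ` (`integral_newtonNear_mul_laplacian`) applied to
`φ = W(x - ·)`, letting `ρ → ∞`. [cite: GilbargTrudinger2001, (2.17)] -/
theorem eq_integral_newtonKernel_mul_laplacian {W : E3 → ℝ} (hW : ContDiff ℝ 2 W) {S : ℝ}
    (hS : ∀ y : E3, S < ‖y‖ → (Δ W) y = 0) (hW0 : Tendsto W (cobounded E3) (𝓝 0)) (x : E3) :
    W x = ∫ y, newtonKernel (x - y) * (Δ W) y := by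
  have hL0 : 0 ≤ ∫ w : E3, |newtonFarLaplacian 1 2 w| := integral_nonneg fun _ ↦ abs_nonneg _
  -- smallness of `W` at infinity
  have hsmall : ∀ ε : ℝ, 0 < ε → ∃ M : ℝ, ∀ w : E3, M ≤ ‖w‖ → |W w| ≤ ε := by
    intro ε hε
    obtain ⟨M, -, hM⟩ := (Filter.hasBasis_cobounded_norm.tendsto_left_iff.1 hW0)
      (closedBall (0 : ℝ) ε) (closedBall_mem_nhds _ hε)
    refine ⟨M, fun w hw ↦ ?_⟩
    have := hM hw
    rwa [mem_closedBall_zero_iff, Real.norm_eq_abs] at this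
  -- Green's identity at scale `ρ`
  have key : ∀ ρ : ℝ, 0 < ρ → ‖x‖ + S ≤ ρ →
      W x - (∫ y, newtonKernel (x - y) * (Δ W) y) =
        ∫ z, newtonFarLaplacian ρ (ρ * 2) z * W (x - z) := by
    intro ρ hρ hρS
    have h₁ : ρ < ρ * 2 := by linarith
    have hφ : ContDiff ℝ 2 fun z : E3 ↦ W (x - z) := hW.comp (contDiff_const.sub contDiff_id)
    have hGreen := integral_newtonNear_mul_laplacian hρ h₁ hφ
    have hlhs : (∫ z, newtonNear ρ (ρ * 2) z * (Δ fun w : E3 ↦ W (x - w)) z) =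
        ∫ y, newtonKernel (x - y) * (Δ W) y := by
      have h1 : (fun z : E3 ↦ newtonNear ρ (ρ * 2) z * (Δ fun w : E3 ↦ W (x - w)) z) =
          fun z ↦ newtonKernel z * (Δ W) (x - z) := by
        funext z
        rw [laplacian_comp_const_sub]
        by_cases hz : (Δ W) (x - z) = 0
        · rw [hz, mul_zero, mul_zero]
        · have hxz : ‖x - z‖ ≤ S := not_lt.1 fun h ↦ hz (hS _ h)
          have hzx : ‖z‖ ≤ ‖x‖ + ‖x - z‖ := by
            calc ‖z‖ = ‖x - (x - z)‖ := by rw [sub_sub_cancel]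
              _ ≤ ‖x‖ + ‖x - z‖ := norm_sub_le _ _
          rw [newtonNear_eq_newtonKernel hρ.le h₁ (by linarith)]
      have h2 : (∫ y : E3, newtonKernel (x - y) * (Δ W) (x - (x - y))) =
          ∫ z : E3, newtonKernel z * (Δ W) (x - z) :=
        integral_sub_left_eq_self (fun z : E3 ↦ newtonKernel z * (Δ W) (x - z)) volume x
      rw [h1, ← h2]
      simp only [sub_sub_cancel]
    rw [hlhs] at hGreen
    simp only [sub_zero] at hGreen
    linarith
  -- hence `|W x - ∫ Γ(x - y) ΔW(y) dy| ≤ ‖λ^{1,2}‖₁ ε` for every `ε > 0`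
  have hbound : ∀ ε : ℝ, 0 < ε →
      |W x - ∫ y, newtonKernel (x - y) * (Δ W) y| ≤ (∫ w : E3, |newtonFarLaplacian 1 2 w|) * ε := by
    intro ε hε
    obtain ⟨M, hM⟩ := hsmall ε hε
    set ρ : ℝ := max 1 (max (‖x‖ + S) (‖x‖ + M)) with hρ_def
    have hρ : 0 < ρ := lt_of_lt_of_le one_pos (le_max_left _ _)
    have hρS : ‖x‖ + S ≤ ρ := (le_max_left _ _).trans (le_max_right _ _)
    have hρM : ‖x‖ + M ≤ ρ := (le_max_right _ _).trans (le_max_right _ _)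
    have h₁ : ρ < ρ * 2 := by linarith
    rw [key ρ hρ hρS]
    have hLρ : (∫ z : E3, |newtonFarLaplacian ρ (ρ * 2) z|) =
        ∫ w : E3, |newtonFarLaplacian 1 2 w| := by
      have := integral_abs_newtonFarLaplacian_scale hρ 1 2
      rwa [mul_one] at this
    have hint : Integrable fun z : E3 ↦ |newtonFarLaplacian ρ (ρ * 2) z| * ε :=
      (integrable_newtonFarLaplacian hρ h₁).abs.mul_const ε
    calc |∫ z, newtonFarLaplacian ρ (ρ * 2) z * W (x - z)|
        = ‖∫ z, newtonFarLaplacian ρ (ρ * 2) z * W (x - z)‖ := (Real.norm_eq_abs _).symm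
      _ ≤ ∫ z, |newtonFarLaplacian ρ (ρ * 2) z| * ε := by
        refine norm_integral_le_of_norm_le hint (Eventually.of_forall fun z ↦ ?_)
        rw [norm_mul, Real.norm_eq_abs, Real.norm_eq_abs]
        by_cases hz : ‖z‖ < ρ
        · rw [newtonFarLaplacian_eq_zero_of_lt hρ.le h₁ hz]
          simp
        · refine mul_le_mul_of_nonneg_left (hM _ ?_) (abs_nonneg _)
          have hz' := not_lt.1 hz
          have := norm_sub_norm_le z x
          rw [norm_sub_rev] at this
          linarith
      _ = (∫ w : E3, |newtonFarLaplacian 1 2 w|) * ε := by rw [integral_mul_const, hLρ]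
  -- conclude
  have h0 : |W x - ∫ y, newtonKernel (x - y) * (Δ W) y| ≤ 0 := by
    refine le_of_forall_pos_le_add fun ε hε ↦ ?_
    have hL1 : 0 < (∫ w : E3, |newtonFarLaplacian 1 2 w|) + 1 := by linarith
    have h := hbound (ε / ((∫ w : E3, |newtonFarLaplacian 1 2 w|) + 1)) (div_pos hε hL1)
    refine h.trans ?_
    rw [zero_add, mul_div_assoc', div_le_iff₀ hL1]
    nlinarith
  exact sub_eq_zero.1 (abs_nonpos_iff.1 h0)

/-! ### Far field of a Newtonian potential -/

/-- Off the support of a continuous compactly supported density `f` (vanishing off `|y| ≤ S`),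
the integrand `y ↦ Γ(x - y) f(y)` of the Newtonian potential agrees with the continuous
compactly supported `Γ∞^{d/2,d}(x - y) f(y)`, `d = |x| - S`, hence is integrable. [folklore] -/
theorem integrable_newtonKernel_sub_mul {f : E3 → ℝ} (hf : Continuous f)
    (hcs : HasCompactSupport f) {S : ℝ} (hsupp : ∀ y : E3, S < ‖y‖ → f y = 0) {x : E3}
    (hx : S < ‖x‖) : Integrable fun y ↦ newtonKernel (x - y) * f y := by
  set d : ℝ := ‖x‖ - S with hd_def
  have hd : 0 < d := sub_pos.2 hx
  have h0 : 0 < d / 2 := half_pos hd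
  have h1 : d / 2 < d := half_lt_self hd
  have heq : (fun y ↦ newtonKernel (x - y) * f y) =
      fun y ↦ newtonFar (d / 2) d (x - y) * f y := by
    funext y
    by_cases hy : f y = 0
    · rw [hy, mul_zero, mul_zero]
    · have hyS : ‖y‖ ≤ S := not_lt.1 fun h ↦ hy (hsupp y h)
      have hxy : d ≤ ‖x - y‖ := by
        have := norm_sub_norm_le x y
        linarith
      rw [newtonFar_eq_newtonKernel h0.le h1 hxy]
  rw [heq]
  exact (((contDiff_newtonFar h0 h1 (n := 0)).continuous.comp
    (continuous_const.sub continuous_id)).mul hf).integrable_of_hasCompactSupport hcs.mul_left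

/-- **Far field of the Newtonian potential of a compactly supported density.** If `f` is
continuous on `ℝ³` and vanishes off `|y| ≤ S` (`S ≥ 0`), then at infinity
`∫ Γ(x - y) f(y) dy = -(4π)⁻¹ (∫ f) |x|⁻¹ + O(|x|⁻²)`: for `|x| ≥ 2S + 1` and `|y| ≤ S`,
`|Γ(x - y) - Γ(x)| = (4π)⁻¹ ||x - y| - |x|| / (|x| |x - y|) ≤ (4π)⁻¹ S / (|x| · |x|/2)`, so the
error is at most `(S/2π) ‖f‖₁ |x|⁻²` (the monopole term of the expansion at infinity,
Gilbarg–Trudinger §2.4). [folklore] -/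
theorem newtonPotential_sub_isBigO {f : E3 → ℝ} (hf : Continuous f) {S : ℝ} (hS : 0 ≤ S)
    (hsupp : ∀ y : E3, S < ‖y‖ → f y = 0) :
    (fun x : E3 ↦ (∫ y, newtonKernel (x - y) * f y) - (-(4 * π)⁻¹ * ∫ y, f y) * ‖x‖⁻¹)
      =O[cobounded E3] fun x ↦ ‖x‖ ^ (-2 : ℝ) := by
  have hcs : HasCompactSupport f := by
    refine HasCompactSupport.intro (isCompact_closedBall (0 : E3) S) fun y hy ↦ hsupp y ?_
    rwa [mem_closedBall_zero_iff, not_le] at hy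
  have hfi : Integrable f := hf.integrable_of_hasCompactSupport hcs
  refine IsBigO.of_bound (S / (2 * π) * ∫ y, |f y|) ?_
  filter_upwards [eventually_cobounded_le_norm (2 * S + 1)] with x hx
  have hx0 : 0 < ‖x‖ := by linarith
  have hxne : ‖x‖ ≠ 0 := hx0.ne'
  have hxS : S < ‖x‖ := by linarith
  have hint := integrable_newtonKernel_sub_mul hf hcs hsupp hxS
  -- the difference as a single integral
  have hdiff : (∫ y, newtonKernel (x - y) * f y) - (-(4 * π)⁻¹ * ∫ y, f y) * ‖x‖⁻¹ =
      ∫ y, (newtonKernel (x - y) - newtonKernel x) * f y := by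
    have h1 : (-(4 * π)⁻¹ * ∫ y, f y) * ‖x‖⁻¹ = ∫ y, newtonKernel x * f y := by
      rw [integral_const_mul, newtonKernel_eq, mul_inv]
      ring
    rw [h1, ← integral_sub hint (hfi.const_mul _)]
    refine integral_congr_ae (Eventually.of_forall fun y ↦ ?_)
    show newtonKernel (x - y) * f y - newtonKernel x * f y = _
    ring
  rw [hdiff, Real.norm_of_nonneg (Real.rpow_nonneg (norm_nonneg _) _),
    Real.rpow_neg (norm_nonneg _), Real.rpow_two]
  -- pointwise kernel bound on the support
  have hker : ∀ y : E3, f y ≠ 0 →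
      |newtonKernel (x - y) - newtonKernel x| ≤ S / (2 * π) * (‖x‖ ^ 2)⁻¹ := by
    intro y hy
    have hyS : ‖y‖ ≤ S := not_lt.1 fun h ↦ hy (hsupp y h)
    have hxy : ‖x‖ / 2 ≤ ‖x - y‖ := by
      have := norm_sub_norm_le x y
      linarith
    have hxy0 : 0 < ‖x - y‖ := by linarith
    have hxyne : ‖x - y‖ ≠ 0 := hxy0.ne'
    have hnum : |‖x - y‖ - ‖x‖| ≤ S := by
      have := abs_norm_sub_norm_le (x - y) x
      rw [sub_sub_cancel_left, norm_neg] at this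
      exact this.trans hyS
    have hrepr : newtonKernel (x - y) - newtonKernel x =
        (4 * π)⁻¹ * ((‖x - y‖ - ‖x‖) / (‖x‖ * ‖x - y‖)) := by
      rw [newtonKernel_eq, newtonKernel_eq]
      field_simp
      ring
    have hfrac : |‖x - y‖ - ‖x‖| / (‖x‖ * ‖x - y‖) ≤ S / (‖x‖ * (‖x‖ / 2)) :=
      div_le_div₀ hS hnum (by positivity) (mul_le_mul_of_nonneg_left hxy (norm_nonneg _))
    rw [hrepr, abs_mul, abs_of_pos (by positivity : (0 : ℝ) < (4 * π)⁻¹), abs_div,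
      abs_of_pos (by positivity : (0 : ℝ) < ‖x‖ * ‖x - y‖)]
    calc (4 * π)⁻¹ * (|‖x - y‖ - ‖x‖| / (‖x‖ * ‖x - y‖))
        ≤ (4 * π)⁻¹ * (S / (‖x‖ * (‖x‖ / 2))) := mul_le_mul_of_nonneg_left hfrac (by positivity)
      _ = S / (2 * π) * (‖x‖ ^ 2)⁻¹ := by
        field_simp
        ring
  calc ‖∫ y, (newtonKernel (x - y) - newtonKernel x) * f y‖
      ≤ ∫ y, S / (2 * π) * (‖x‖ ^ 2)⁻¹ * |f y| := by
        refine norm_integral_le_of_norm_le (hfi.abs.const_mul _) (Eventually.of_forall fun y ↦ ?_)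
        rw [norm_mul, Real.norm_eq_abs, Real.norm_eq_abs]
        by_cases hy : f y = 0
        · rw [hy, abs_zero, mul_zero, mul_zero]
        · exact mul_le_mul_of_nonneg_right (hker y hy) (abs_nonneg _)
    _ = S / (2 * π) * (∫ y, |f y|) * (‖x‖ ^ 2)⁻¹ := by
        rw [integral_const_mul]
        ring

/-! ### The discharge -/

/-- **Bray's expansion (10) holds** (discharge of the named fact
`Bray2001_harmonicFactor_expansion`): a function on `ℝ³` harmonic on `{R₁ < |x|}` and tending to
`a` at infinity satisfies `U(x) = a + b/|x| + O(|x|⁻²)`. Bray, J. Differential Geom. 59 (2001),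
§2, (10) (there via spherical harmonics); here `b = -(4π)⁻¹ ∫ Δ((1 - θ)(U - a))` for the radial
cutoff `θ = θ_{R+1,R+2}` of the hole, `R = max R₁ 1`, by Green's representation formula
(`eq_integral_newtonKernel_mul_laplacian`) and the far-field expansion of the Newtonian
potential (`newtonPotential_sub_isBigO`). [cite: BrayRPI2001, §2 (10)] -/
theorem Bray2001_harmonicFactor_expansion_holds : Bray2001_harmonicFactor_expansion := by
  intro R₁ U a hU ha
  -- an enlarged positive radius
  set R : ℝ := max R₁ 1 with hR_def
  have hR0 : 0 < R := lt_of_lt_of_le one_pos (le_max_right _ _)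
  have hR1 : R₁ ≤ R := le_max_left _ _
  -- `V = U - a` is harmonic beyond `R` and tends to `0`
  set V : E3 → ℝ := fun x ↦ U x - a with hV_def
  have hV : ∀ x : E3, R < ‖x‖ → HarmonicAt V x := fun x hx ↦
    (hU x (lt_of_le_of_lt hR1 hx)).sub (harmonicAt_const a)
  have hV0 : Tendsto V (cobounded E3) (𝓝 0) := by
    have := ha.sub_const a
    rwa [sub_self] at this
  -- the cut-off function `W = (1 - θ) V`
  have h01 : (0 : ℝ) ≤ R + 1 := by linarith
  have h12 : R + 1 < R + 2 := by linarith
  set W : E3 → ℝ := fun x ↦ (1 - radialCutoff (R + 1) (R + 2) x) * V x with hW_def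
  have hWV : ∀ x : E3, R + 2 < ‖x‖ → W =ᶠ[𝓝 x] V := fun x hx ↦ by
    filter_upwards [radialCutoff_eventuallyEq_zero (E := E3) h01 h12 hx] with y hy
    simp only [hW_def, hy, sub_zero, one_mul]
  have hW0 : ∀ x : E3, ‖x‖ < R + 1 → W =ᶠ[𝓝 x] fun _ ↦ (0 : ℝ) := fun x hx ↦ by
    filter_upwards [radialCutoff_eventuallyEq_one (E := E3) h01 h12 hx] with y hy
    simp only [hW_def, hy, sub_self, zero_mul]
  have hW2 : ContDiff ℝ 2 W := by
    refine contDiff_iff_contDiffAt.2 fun x ↦ ?_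
    by_cases hx : R < ‖x‖
    · exact ((contDiff_const.sub
        (radialCutoff_contDiff (E' := E3) (R + 1) (R + 2))).contDiffAt).mul (hV x hx).1
    · have hx' := not_lt.1 hx
      exact (contDiffAt_const (c := (0 : ℝ))).congr_of_eventuallyEq (hW0 x (by linarith))
  have hΔW : ∀ x : E3, R + 2 < ‖x‖ → (Δ W) x = 0 := fun x hx ↦ by
    rw [(laplacian_congr_nhds (hWV x hx)).eq_of_nhds]
    exact (hV x (by linarith)).2.eq_of_nhds
  have hWlim : Tendsto W (cobounded E3) (𝓝 0) := by
    refine hV0.congr' ?_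
    filter_upwards [eventually_cobounded_le_norm (R + 2)] with y hy
    show V y = (1 - radialCutoff (R + 1) (R + 2) y) * V y
    rw [radialCutoff_eq_zero h01 h12 hy, sub_zero, one_mul]
  -- Green's representation of `W` and the far field of the Newtonian potential of `ΔW`
  have hrep := eq_integral_newtonKernel_mul_laplacian hW2 hΔW hWlim
  have hexp := newtonPotential_sub_isBigO (continuous_laplacian hW2)
    (by linarith : (0 : ℝ) ≤ R + 2) hΔW
  refine ⟨-(4 * π)⁻¹ * ∫ y, (Δ W) y, ?_⟩
  unfold HasHarmonicExpansion
  refine hexp.congr' ?_ EventuallyEq.rfl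
  filter_upwards [eventually_cobounded_le_norm (R + 3)] with x hx
  have hWx : W x = V x := (hWV x (by linarith)).eq_of_nhds
  have hVx : V x = U x - a := rfl
  rw [← hrep x, hWx, hVx]
  ring

end Literature.Geometry.Lorentzian

end
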